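import Summits.NavierStokesRegularity.NavierStokesRegularity.Theorems.ExtremiserTransienceKStarAttainedContact
import HarnessLib

/-!
# Crux `ExtremiserTransience.NearExtremalTransience` (stmt-NavierStokesRegularity-21883), line `extremiser_liouville`,
# stub K1b `stub_noAnalyticExtremal` — THE EXTENDED (NON-`L²`) PLATEAU ARGUMENT: K1b ⟸ extended sharp inequality ∧ no «plateau at infinity» extremiser

`--supports stmt-NavierStokesRegularity-21883` (helper).  Author: prover seat `ns-el-k1b` (g0).

The tree's non-attainment theorem `DepletionLadder.KStar.not_attained_of_analyticOnNhd` (item 24370's files `…KStarAttained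
{Variation, Density, ConePotential, Contact}`) uses `v ∈ L²` in exactly two places: (a) ADMISSIBILITY of the perturbed fields
`v + εφ`, to which the universal constant `κ⋆` is applied, and (b) DECAY (`exists_radius_norm_lt`: `‖v‖ < M/2` off a ball), to
build the two-sided cut-off perturbation `φ_R = curl(χ · conePotential v)` and to contradict `‖v‖ ≡ M`.  This file re-runs the
chain for the stub's EXTENDED class (no `L²`) with (a) replaced by the HYPOTHESIS `hext` — the sharp inequality on the extended
class (which follows from a density lemma and the PROVED `ExtremiserLiouville.noGainFromConstants`, see
`…ExtremiserLiouvilleNoAnalyticExtremalReduction`) — and (b) replaced by a FAR-FIELD GAP `‖w‖ ≤ M' < M` off a ball: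
* `ext_firstVariation_eq_of_normBound`, `ext_firstVariation_eq_zero_offContact` — Euler–Lagrange identities of an extended
  extremiser (verbatim ports of `KStar.firstVariation_*`);
* `ext_exists_normBound_cutoff` — the two-sided norm bound `‖w + εφ_R‖ ≤ (1+ε)M` from a far-field gap `M' < M`
  (port of `KStar.exists_normBound_cutoff`, `M/2 ↦ M'`);
* `ext_interior_contact_nonempty`, `ext_not_extremal_of_analytic_of_farFieldGap` — an analytic extended extremiser cannot have
  a far-field gap (plateau with interior ⇒ `‖w‖ ≡ M` by analyticity ⇒ contradiction off the ball);
* **`stub_noAnalyticExtremal_of_extendedSharp_of_noPlateauAtInfinity`** — the registered stub VERBATIM follows from `hext` and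
  the exclusion of analytic extended extremisers WHOSE SUP IS APPROACHED AT INFINITY
  (`∀ M' < M, ∀ R, ∃ x, ‖x‖ ≥ R ∧ ‖w x‖ > M'`): the «plateau at infinity», where `φ_R` admits only a one-sided norm bound and
  the argument above gives no contradiction.  That residual statement is NOT proved here; it is where K1b's difficulty now sits
  (example of a field of the class with empty contact set and sup attained only at infinity: `c + λ·curl(−(1+‖x‖²)^(−a/2)·½ c × x)`,
  `½ < a < 2`).

WHAT THIS IS NOT: not K1b; K1b is a STATIC statement about analytic κ⋆-efficient fields; the crux NET, rung N0 and NS regularity stay OPEN — nothing here proves NS regularity. [folklore]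
-/

noncomputable section

open Set Filter Topology MeasureTheory Metric
open scoped InnerProductSpace RealInnerProductSpace ENNReal NNReal ContDiff
open Literature.Analysis.FluidPDE

namespace Summit.NavierStokesRegularity.NavierStokesRegularity.Theorems

-- the problem directory repeats the summit name (`NavierStokesRegularity/NavierStokesRegularity`)
set_option linter.dupNamespace false

namespace ExtremiserLiouville

open DepletionLadder.KStar

variable {v φ : EuclideanSpace ℝ (Fin 3) → EuclideanSpace ℝ (Fin 3)}

/-! ## First variation of an EXTENDED extremiser (no `L²`; the sharp inequality on the extended class is a hypothesis) -/

/-- **First variation under a norm bound, extended class** (port of `KStar.firstVariation_eq_of_normBound`: the admissibility of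
`v + εφ` and the universality of `κ⋆` are replaced by the hypothesis `hext`). [folklore] -/
theorem ext_firstVariation_eq_of_normBound
    (hext : ∀ (w : EuclideanSpace ℝ (Fin 3) → EuclideanSpace ℝ (Fin 3)) (M B : ℝ), ContDiff ℝ (⊤ : ℕ∞) w → Literature.Analysis.FluidPDE.VectorCalculus.IsDivFree w → (∀ x, ‖w x‖ ≤ M) → (∀ x, ‖fderiv ℝ w x‖ ≤ B) → (∫⁻ x, ‖iteratedFDeriv ℝ 1 w x‖ₑ ^ 2 < ⊤) → (∫⁻ x, ‖iteratedFDeriv ℝ 2 w x‖ₑ ^ 2 < ⊤) → |∫ x, ⟪Literature.Analysis.FluidPDE.curl w x, fderiv ℝ w x (Literature.Analysis.FluidPDE.curl w x)⟫_ℝ| ≤ (sInf {κ : ℝ | (∀ (v : EuclideanSpace ℝ (Fin 3) → EuclideanSpace ℝ (Fin 3)) (M B : ℝ), ContDiff ℝ (⊤ : ℕ∞) v → Literature.Analysis.FluidPDE.VectorCalculus.IsDivFree v → (∀ x, ‖v x‖ ≤ M) → (∀ x, ‖fderiv ℝ v x‖ ≤ B) → (∫⁻ x, ‖iteratedFDeriv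 ℝ 0 v x‖ₑ ^ 2 < ⊤) → (∫⁻ x, ‖iteratedFDeriv ℝ 1 v x‖ₑ ^ 2 < ⊤) → (∫⁻ x, ‖iteratedFDeriv ℝ 2 v x‖ₑ ^ 2 < ⊤) → |∫ x, ⟪Literature.Analysis.FluidPDE.curl v x, fderiv ℝ v x (Literature.Analysis.FluidPDE.curl v x)⟫_ℝ| ≤ κ * M * Real.sqrt (∫ x, ‖Literature.Analysis.FluidPDE.curl v x‖ ^ 2) * Real.sqrt (∫ x, Literature.Analysis.FluidPDE.frobeniusNormSq (fderiv ℝ (Literature.Analysis.FluidPDE.curl v) x)))}) * M * Real.sqrt (∫ x, ‖Literature.Analysis.FluidPDE.curl w x‖ ^ 2) * Real.sqrt (∫ x, Literature.Analysis.FluidPDE.frobeniusNormSq (fderiv ℝ (Literature.Analysis.FluidPDE.curl w) x)))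
    (hv : ContDiff ℝ ∞ v) (hdiv : VectorCalculus.IsDivFree v)
    {M B : ℝ} (hB : ∀ x, ‖fderiv ℝ v x‖ ≤ B)
    (h1 : ∫⁻ x, ‖iteratedFDeriv ℝ 1 v x‖ₑ ^ 2 < ⊤) (h2 : ∫⁻ x, ‖iteratedFDeriv ℝ 2 v x‖ₑ ^ 2 < ⊤)
    (hatt : |∫ x, ⟪curl v x, fderiv ℝ v x (curl v x)⟫| = (sInf {κ : ℝ | (∀ (v : EuclideanSpace ℝ (Fin 3) → EuclideanSpace ℝ (Fin 3)) (M B : ℝ), ContDiff ℝ (⊤ : ℕ∞) v → Literature.Analysis.FluidPDE.VectorCalculus.IsDivFree v → (∀ x, ‖v x‖ ≤ M) → (∀ x, ‖fderiv ℝ v x‖ ≤ B) → (∫⁻ x, ‖iteratedFDeriv ℝ 0 v x‖ₑ ^ 2 < ⊤) → (∫⁻ x, ‖iteratedFDeriv ℝ 1 v x‖ₑ ^ 2 < ⊤) → (∫⁻ x, ‖iteratedFDeriv ℝ 2 v x‖ₑ ^ 2 < ⊤) → |∫ x, ⟪Literature.Analysis.FluidPDE.curl v x, fderiv ℝ v x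 (Literature.Analysis.FluidPDE.curl v x)⟫_ℝ| ≤ κ * M * Real.sqrt (∫ x, ‖Literature.Analysis.FluidPDE.curl v x‖ ^ 2) * Real.sqrt (∫ x, Literature.Analysis.FluidPDE.frobeniusNormSq (fderiv ℝ (Literature.Analysis.FluidPDE.curl v) x)))}) * M * Real.sqrt (∫ x, ‖curl v x‖ ^ 2) * Real.sqrt (∫ x, frobeniusNormSq (fderiv ℝ (curl v) x)))
    (hφ : ContDiff ℝ ∞ φ) (hφc : HasCompactSupport φ) (hφdiv : VectorCalculus.IsDivFree φ)
    {m ε₀ : ℝ} (hε₀ : 0 < ε₀) (hbound : ∀ ε : ℝ, |ε| < ε₀ → ∀ x, ‖v x + ε • φ x‖ ≤ (1 + m * ε) * M) :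
    (∫ x, ⟪curl v x, fderiv ℝ v x (curl v x)⟫) * (∫ x, (⟪curl φ x, fderiv ℝ v x (curl v x)⟫ + ⟪curl v x, fderiv ℝ φ x (curl v x)⟫ + ⟪curl v x, fderiv ℝ v x (curl φ x)⟫)) =
      (sInf {κ : ℝ | (∀ (v : EuclideanSpace ℝ (Fin 3) → EuclideanSpace ℝ (Fin 3)) (M B : ℝ), ContDiff ℝ (⊤ : ℕ∞) v → Literature.Analysis.FluidPDE.VectorCalculus.IsDivFree v → (∀ x, ‖v x‖ ≤ M) → (∀ x, ‖fderiv ℝ v x‖ ≤ B) → (∫⁻ x, ‖iteratedFDeriv ℝ 0 v x‖ₑ ^ 2 < ⊤) → (∫⁻ x, ‖iteratedFDeriv ℝ 1 v x‖ₑ ^ 2 < ⊤) → (∫⁻ x, ‖iteratedFDeriv ℝ 2 v x‖ₑ ^ 2 < ⊤) → |∫ x, ⟪Literature.Analysis.FluidPDE.curl v x, fderiv ℝ v x (Literature.Analysis.FluidPDE.curl v x)⟫_ℝ| ≤ κ * M * Real.sqrt (∫ x, ‖Literature.Analysis.FluidPDE.curl v x‖ ^ 2) * Real.sqrt (∫ x,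 Literature.Analysis.FluidPDE.frobeniusNormSq (fderiv ℝ (Literature.Analysis.FluidPDE.curl v) x)))}) ^ 2 * M ^ 2 * (m * (∫ x, ‖curl v x‖ ^ 2) * (∫ x, frobeniusNormSq (fderiv ℝ (curl v) x)) + (∫ x, frobeniusNormSq (fderiv ℝ (curl v) x)) * (∫ x, ⟪curl v x, curl φ x⟫) + (∫ x, ‖curl v x‖ ^ 2) * (∫ x, ∑ i, ⟪fderiv ℝ (curl v) x (EuclideanSpace.basisFun (Fin 3) ℝ i), fderiv ℝ (curl φ) x (EuclideanSpace.basisFun (Fin 3) ℝ i)⟫)) := by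
  set K : ℝ := (sInf {κ : ℝ | (∀ (v : EuclideanSpace ℝ (Fin 3) → EuclideanSpace ℝ (Fin 3)) (M B : ℝ), ContDiff ℝ (⊤ : ℕ∞) v → Literature.Analysis.FluidPDE.VectorCalculus.IsDivFree v → (∀ x, ‖v x‖ ≤ M) → (∀ x, ‖fderiv ℝ v x‖ ≤ B) → (∫⁻ x, ‖iteratedFDeriv ℝ 0 v x‖ₑ ^ 2 < ⊤) → (∫⁻ x, ‖iteratedFDeriv ℝ 1 v x‖ₑ ^ 2 < ⊤) → (∫⁻ x, ‖iteratedFDeriv ℝ 2 v x‖ₑ ^ 2 < ⊤) → |∫ x, ⟪Literature.Analysis.FluidPDE.curl v x, fderiv ℝ v x (Literature.Analysis.FluidPDE.curl v x)⟫_ℝ| ≤ κ * M * Real.sqrt (∫ x, ‖Literature.Analysis.FluidPDE.curl v x‖ ^ 2) * Real.sqrt (∫ x, Literature.Analysis.FluidPDE.frobeniusNormSq (fderiv ℝ (Literature.Analysis.FluidPDE.curl v) x)))}) with hK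
  have hZ0 : 0 ≤ (∫ x, ‖curl v x‖ ^ 2) := integral_nonneg fun x => sq_nonneg _
  have hW0 : 0 ≤ (∫ x, frobeniusNormSq (fderiv ℝ (curl v) x)) := integral_nonneg fun x => frobeniusNormSq_nonneg _
  have hvd : Differentiable ℝ v := hv.differentiable (by simp)
  have hφd : Differentiable ℝ φ := hφ.differentiable (by simp)
  obtain ⟨C, hC⟩ := (hφ.continuous_fderiv (by simp)).bounded_above_of_compact_support (hφc.fderiv (𝕜 := ℝ))
  refine linear_coeff_eq_of_sq_le hε₀
    (J₂ := ∫ x, (⟪curl φ x, fderiv ℝ φ x (curl v x)⟫ + ⟪curl φ x, fderiv ℝ v x (curl φ x)⟫ +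
      ⟪curl v x, fderiv ℝ φ x (curl φ x)⟫))
    (J₃ := ∫ x, ⟪curl φ x, fderiv ℝ φ x (curl φ x)⟫) (a₂ := ∫ x, ‖curl φ x‖ ^ 2)
    (c₂ := ∫ x, frobeniusNormSq (fderiv ℝ (curl φ) x)) ?_ fun ε hε => ?_
  · calc (∫ x, ⟪curl v x, fderiv ℝ v x (curl v x)⟫) ^ 2 = |∫ x, ⟪curl v x, fderiv ℝ v x (curl v x)⟫| ^ 2 := (sq_abs _).symm
      _ = (K * M * Real.sqrt (∫ x, ‖curl v x‖ ^ 2) * Real.sqrt (∫ x, frobeniusNormSq (fderiv ℝ (curl v) x))) ^ 2 := by rw [hatt]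
      _ = K ^ 2 * M ^ 2 * (∫ x, ‖curl v x‖ ^ 2) * (∫ x, frobeniusNormSq (fderiv ℝ (curl v) x)) := by
          rw [mul_pow, mul_pow, mul_pow, Real.sq_sqrt hZ0, Real.sq_sqrt hW0]
  · -- the perturbed field is in the extended class
    have hcd : ContDiff ℝ ∞ (fun y => v y + ε • φ y) := hv.add (hφ.const_smul ε)
    have hdv : VectorCalculus.IsDivFree (fun y => v y + ε • φ y) := fun x => by
      rw [divergence_add_smul hvd hφd, hdiv x, hφdiv x, mul_zero, add_zero]
    have hB' : ∀ x, ‖fderiv ℝ (fun y => v y + ε • φ y) x‖ ≤ B + |ε| * C := fun x => by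
      rw [fderiv_add_smul hvd hφd]
      calc ‖fderiv ℝ v x + ε • fderiv ℝ φ x‖ ≤ ‖fderiv ℝ v x‖ + ‖ε • fderiv ℝ φ x‖ := norm_add_le _ _
        _ = ‖fderiv ℝ v x‖ + |ε| * ‖fderiv ℝ φ x‖ := by rw [norm_smul, Real.norm_eq_abs]
        _ ≤ B + |ε| * C := add_le_add (hB x) (mul_le_mul_of_nonneg_left (hC x) (abs_nonneg ε))
    have h1' := lintegral_iteratedFDeriv_add_smul_lt_top hv hφ hφc ε h1
    have h2' := lintegral_iteratedFDeriv_add_smul_lt_top hv hφ hφc ε h2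
    have hu := hext _ ((1 + m * ε) * M) (B + |ε| * C) hcd hdv (hbound ε hε) hB' h1' h2'
    have hZε : 0 ≤ ∫ x, ‖curl (fun y => v y + ε • φ y) x‖ ^ 2 := integral_nonneg fun x => sq_nonneg _
    have hWε : 0 ≤ ∫ x, frobeniusNormSq (fderiv ℝ (curl (fun y => v y + ε • φ y)) x) :=
      integral_nonneg fun x => frobeniusNormSq_nonneg _
    have hsq : (∫ x, ⟪curl (fun y => v y + ε • φ y) x,
        fderiv ℝ (fun y => v y + ε • φ y) x (curl (fun y => v y + ε • φ y) x)⟫) ^ 2 ≤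
        (K * ((1 + m * ε) * M) * Real.sqrt (∫ x, ‖curl (fun y => v y + ε • φ y) x‖ ^ 2) *
          Real.sqrt (∫ x, frobeniusNormSq (fderiv ℝ (curl (fun y => v y + ε • φ y)) x))) ^ 2 := by
      rw [← sq_abs (∫ x, ⟪curl (fun y => v y + ε • φ y) x,
        fderiv ℝ (fun y => v y + ε • φ y) x (curl (fun y => v y + ε • φ y) x)⟫)]
      exact pow_le_pow_left₀ (abs_nonneg _) hu 2
    rw [mul_pow, mul_pow, mul_pow, Real.sq_sqrt hZε, Real.sq_sqrt hWε,
      integral_stretching_add_smul hv hB h1 hφ hφc ε, integral_normSq_curl_add_smul hv h1 hφ hφc ε,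
      integral_frobeniusNormSq_add_smul hv h2 hφ hφc ε] at hsq
    exact hsq

/-- **Euler–Lagrange off the contact set, extended class** (port of `KStar.firstVariation_eq_zero_offContact`). [folklore] -/
theorem ext_firstVariation_eq_zero_offContact
    (hext : ∀ (w : EuclideanSpace ℝ (Fin 3) → EuclideanSpace ℝ (Fin 3)) (M B : ℝ), ContDiff ℝ (⊤ : ℕ∞) w → Literature.Analysis.FluidPDE.VectorCalculus.IsDivFree w → (∀ x, ‖w x‖ ≤ M) → (∀ x, ‖fderiv ℝ w x‖ ≤ B) → (∫⁻ x, ‖iteratedFDeriv ℝ 1 w x‖ₑ ^ 2 < ⊤) → (∫⁻ x, ‖iteratedFDeriv ℝ 2 w x‖ₑ ^ 2 < ⊤) → |∫ x, ⟪Literature.Analysis.FluidPDE.curl w x, fderiv ℝ w x (Literature.Analysis.FluidPDE.curl w x)⟫_ℝ| ≤ (sInf {κ : ℝ | (∀ (v : EuclideanSpace ℝ (Fin 3) → EuclideanSpace ℝ (Fin 3)) (M B : ℝ), ContDiff ℝ (⊤ : ℕ∞) v → Literature.Analysis.FluidPDE.VectorCalculus.IsDivFree v → (∀ x, ‖v x‖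 ≤ M) → (∀ x, ‖fderiv ℝ v x‖ ≤ B) → (∫⁻ x, ‖iteratedFDeriv ℝ 0 v x‖ₑ ^ 2 < ⊤) → (∫⁻ x, ‖iteratedFDeriv ℝ 1 v x‖ₑ ^ 2 < ⊤) → (∫⁻ x, ‖iteratedFDeriv ℝ 2 v x‖ₑ ^ 2 < ⊤) → |∫ x, ⟪Literature.Analysis.FluidPDE.curl v x, fderiv ℝ v x (Literature.Analysis.FluidPDE.curl v x)⟫_ℝ| ≤ κ * M * Real.sqrt (∫ x, ‖Literature.Analysis.FluidPDE.curl v x‖ ^ 2) * Real.sqrt (∫ x, Literature.Analysis.FluidPDE.frobeniusNormSq (fderiv ℝ (Literature.Analysis.FluidPDE.curl v) x)))}) * M * Real.sqrt (∫ x, ‖Literature.Analysis.FluidPDE.curl w x‖ ^ 2) * Real.sqrt (∫ x, Literature.Analysis.FluidPDE.frobeniusNormSq (fderiv ℝ (Literature.Analysis.FluidPDE.curl w) x)))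
    (hv : ContDiff ℝ ∞ v) (hdiv : VectorCalculus.IsDivFree v)
    {M B : ℝ} (hM : ∀ x, ‖v x‖ ≤ M) (hB : ∀ x, ‖fderiv ℝ v x‖ ≤ B)
    (h1 : ∫⁻ x, ‖iteratedFDeriv ℝ 1 v x‖ₑ ^ 2 < ⊤) (h2 : ∫⁻ x, ‖iteratedFDeriv ℝ 2 v x‖ₑ ^ 2 < ⊤)
    (hatt : |∫ x, ⟪curl v x, fderiv ℝ v x (curl v x)⟫| = (sInf {κ : ℝ | (∀ (v : EuclideanSpace ℝ (Fin 3) → EuclideanSpace ℝ (Fin 3)) (M B : ℝ), ContDiff ℝ (⊤ : ℕ∞) v → Literature.Analysis.FluidPDE.VectorCalculus.IsDivFree v → (∀ x, ‖v x‖ ≤ M) → (∀ x, ‖fderiv ℝ v x‖ ≤ B) → (∫⁻ x, ‖iteratedFDeriv ℝ 0 v x‖ₑ ^ 2 < ⊤) → (∫⁻ x, ‖iteratedFDeriv ℝ 1 v x‖ₑ ^ 2 < ⊤) → (∫⁻ x, ‖iteratedFDeriv ℝ 2 v x‖ₑ ^ 2 < ⊤) → |∫ x, ⟪Literature.Analysis.FluidPDE.curl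 v x, fderiv ℝ v x (Literature.Analysis.FluidPDE.curl v x)⟫_ℝ| ≤ κ * M * Real.sqrt (∫ x, ‖Literature.Analysis.FluidPDE.curl v x‖ ^ 2) * Real.sqrt (∫ x, Literature.Analysis.FluidPDE.frobeniusNormSq (fderiv ℝ (Literature.Analysis.FluidPDE.curl v) x)))}) * M * Real.sqrt (∫ x, ‖curl v x‖ ^ 2) * Real.sqrt (∫ x, frobeniusNormSq (fderiv ℝ (curl v) x)))
    (hφ : ContDiff ℝ ∞ φ) (hφc : HasCompactSupport φ) (hφdiv : VectorCalculus.IsDivFree φ)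
    (hsupp : tsupport φ ⊆ {x | ‖v x‖ < M}) :
    (∫ x, ⟪curl v x, fderiv ℝ v x (curl v x)⟫) * (∫ x, (⟪curl φ x, fderiv ℝ v x (curl v x)⟫ + ⟪curl v x, fderiv ℝ φ x (curl v x)⟫ + ⟪curl v x, fderiv ℝ v x (curl φ x)⟫)) = (sInf {κ : ℝ | (∀ (v : EuclideanSpace ℝ (Fin 3) → EuclideanSpace ℝ (Fin 3)) (M B : ℝ), ContDiff ℝ (⊤ : ℕ∞) v → Literature.Analysis.FluidPDE.VectorCalculus.IsDivFree v → (∀ x, ‖v x‖ ≤ M) → (∀ x, ‖fderiv ℝ v x‖ ≤ B) → (∫⁻ x, ‖iteratedFDeriv ℝ 0 v x‖ₑ ^ 2 < ⊤) → (∫⁻ x, ‖iteratedFDeriv ℝ 1 v x‖ₑ ^ 2 < ⊤) → (∫⁻ x, ‖iteratedFDeriv ℝ 2 v x‖ₑ ^ 2 < ⊤) → |∫ x, ⟪Literature.Analysis.FluidPDE.curl v x, fderiv ℝ v x (Literature.Analysis.FluidPDE.curl v x)⟫_ℝ| ≤ κ * M * Real.sqrt (∫ x, ‖Literature.Analysis.FluidPDE.curl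 v x‖ ^ 2) * Real.sqrt (∫ x, Literature.Analysis.FluidPDE.frobeniusNormSq (fderiv ℝ (Literature.Analysis.FluidPDE.curl v) x)))}) ^ 2 * M ^ 2 * ((∫ x, frobeniusNormSq (fderiv ℝ (curl v) x)) * (∫ x, ⟪curl v x, curl φ x⟫) + (∫ x, ‖curl v x‖ ^ 2) * (∫ x, ∑ i, ⟪fderiv ℝ (curl v) x (EuclideanSpace.basisFun (Fin 3) ℝ i), fderiv ℝ (curl φ) x (EuclideanSpace.basisFun (Fin 3) ℝ i)⟫)) := by
  obtain ⟨ε₀, hε₀, hbound⟩ := norm_add_smul_le_of_tsupport_subset hv hM hφ hφc hsupp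
  have h := ext_firstVariation_eq_of_normBound hext hv hdiv hB h1 h2 hatt hφ hφc hφdiv hε₀ hbound
  rw [h]
  ring

/-- **Two-sided norm bound for the cut-off perturbation from a FAR-FIELD GAP** (port of `KStar.exists_normBound_cutoff`
with `M/2 ↦ M'`): if `‖v‖ ≤ M` everywhere and `‖v‖ ≤ M' < M` off `B̄(0,R)`, `χ` a bump with `χ.rIn > R`,
`φ = curl (χ · conePotential v)`, then `‖v + εφ‖ ≤ (1+ε)M` for all `|ε| < ε₀`. [folklore] -/
theorem ext_exists_normBound_cutoff (hv : ContDiff ℝ ∞ v) (hdiv : VectorCalculus.IsDivFree v) {M M' R : ℝ}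
    (hM : ∀ x, ‖v x‖ ≤ M) (hMpos : 0 < M) (hM' : M' < M)
    (hR : ∀ x : EuclideanSpace ℝ (Fin 3), R ≤ ‖x‖ → ‖v x‖ ≤ M')
    (χ : ContDiffBump (0 : EuclideanSpace ℝ (Fin 3))) (hχ : R < χ.rIn) :
    ∃ ε₀ : ℝ, 0 < ε₀ ∧ ∀ ε : ℝ, |ε| < ε₀ → ∀ x,
      ‖v x + ε • curl (fun y => χ y • conePotential v y) x‖ ≤ (1 + (1 : ℝ) * ε) * M := by
  obtain ⟨hφ, hφc, -, hball⟩ := cutoff_field hv hdiv χ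
  obtain ⟨C, hC⟩ := hφ.continuous.bounded_above_of_compact_support hφc
  have hC0 : 0 ≤ C := (norm_nonneg _).trans (hC 0)
  have hgap : 0 < M - M' := sub_pos.2 hM'
  refine ⟨(M - M') / (C + M + 1), by positivity, fun ε hε x => ?_⟩
  have hε1 : |ε| < 1 := by
    refine lt_of_lt_of_le hε ?_
    rw [div_le_one (by positivity)]
    have hM'0 : 0 ≤ M' := by
      obtain ⟨x, hx⟩ := NormedSpace.exists_lt_norm ℝ (EuclideanSpace ℝ (Fin 3)) R
      exact (norm_nonneg _).trans (hR x hx.le)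
    linarith
  have hεle : -(1 : ℝ) < ε := by linarith [neg_abs_le ε]
  rw [one_mul]
  by_cases hx : x ∈ ball (0 : EuclideanSpace ℝ (Fin 3)) χ.rIn
  · rw [hball x hx, show v x + ε • v x = (1 + ε) • v x by rw [add_smul, one_smul], norm_smul]
    calc ‖(1 : ℝ) + ε‖ * ‖v x‖ = (1 + ε) * ‖v x‖ := by
          rw [Real.norm_eq_abs, abs_of_pos (by linarith)]
      _ ≤ (1 + ε) * M := mul_le_mul_of_nonneg_left (hM x) (by linarith)
  · have hxR : R ≤ ‖x‖ := by
      rw [mem_ball, dist_zero_right, not_lt] at hx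
      exact hχ.le.trans hx
    have hvx := hR x hxR
    have hεC : |ε| * ‖curl (fun y => χ y • conePotential v y) x‖ ≤ (M - M') / (C + M + 1) * C :=
      mul_le_mul hε.le (hC x) (norm_nonneg _) (by positivity)
    have hεM : |ε| * M ≤ (M - M') / (C + M + 1) * M := mul_le_mul_of_nonneg_right hε.le hMpos.le
    have hkey : (M - M') / (C + M + 1) * C + (M - M') / (C + M + 1) * M ≤ M - M' := by
      rw [← mul_add, div_mul_eq_mul_div, div_le_iff₀ (by positivity)]
      nlinarith
    calc ‖v x + ε • curl (fun y => χ y • conePotential v y) x‖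
        ≤ ‖v x‖ + ‖ε • curl (fun y => χ y • conePotential v y) x‖ := norm_add_le _ _
      _ = ‖v x‖ + |ε| * ‖curl (fun y => χ y • conePotential v y) x‖ := by rw [norm_smul, Real.norm_eq_abs]
      _ ≤ M' + (M - M') / (C + M + 1) * C := add_le_add hvx hεC
      _ ≤ M - |ε| * M := by linarith
      _ ≤ (1 + ε) * M := by nlinarith [neg_abs_le ε, abs_nonneg ε]

/-! ## The plateau of an extended extremiser with a far-field gap -/

/-- **An extended extremiser with a far-field gap has a speed plateau** (port of `KStar.interior_contact_nonempty`: `h0`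
replaced by `hext` and the far-field gap `‖v‖ ≤ M' < M` off a ball). [folklore] -/
theorem ext_interior_contact_nonempty
    (hext : ∀ (w : EuclideanSpace ℝ (Fin 3) → EuclideanSpace ℝ (Fin 3)) (M B : ℝ), ContDiff ℝ (⊤ : ℕ∞) w → Literature.Analysis.FluidPDE.VectorCalculus.IsDivFree w → (∀ x, ‖w x‖ ≤ M) → (∀ x, ‖fderiv ℝ w x‖ ≤ B) → (∫⁻ x, ‖iteratedFDeriv ℝ 1 w x‖ₑ ^ 2 < ⊤) → (∫⁻ x, ‖iteratedFDeriv ℝ 2 w x‖ₑ ^ 2 < ⊤) → |∫ x, ⟪Literature.Analysis.FluidPDE.curl w x, fderiv ℝ w x (Literature.Analysis.FluidPDE.curl w x)⟫_ℝ| ≤ (sInf {κ : ℝ | (∀ (v : EuclideanSpace ℝ (Fin 3) → EuclideanSpace ℝ (Fin 3)) (M B : ℝ), ContDiff ℝ (⊤ : ℕ∞) v → Literature.Analysis.FluidPDE.VectorCalculus.IsDivFree v → (∀ x, ‖v x‖ ≤ M) → (∀ x, ‖fderiv ℝ v x‖ ≤ B) → (∫⁻ x, ‖iteratedFDeriv ℝ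 0 v x‖ₑ ^ 2 < ⊤) → (∫⁻ x, ‖iteratedFDeriv ℝ 1 v x‖ₑ ^ 2 < ⊤) → (∫⁻ x, ‖iteratedFDeriv ℝ 2 v x‖ₑ ^ 2 < ⊤) → |∫ x, ⟪Literature.Analysis.FluidPDE.curl v x, fderiv ℝ v x (Literature.Analysis.FluidPDE.curl v x)⟫_ℝ| ≤ κ * M * Real.sqrt (∫ x, ‖Literature.Analysis.FluidPDE.curl v x‖ ^ 2) * Real.sqrt (∫ x, Literature.Analysis.FluidPDE.frobeniusNormSq (fderiv ℝ (Literature.Analysis.FluidPDE.curl v) x)))}) * M * Real.sqrt (∫ x, ‖Literature.Analysis.FluidPDE.curl w x‖ ^ 2) * Real.sqrt (∫ x, Literature.Analysis.FluidPDE.frobeniusNormSq (fderiv ℝ (Literature.Analysis.FluidPDE.curl w) x)))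
    (hv : ContDiff ℝ ∞ v) (hdiv : VectorCalculus.IsDivFree v) {M B M' R : ℝ}
    (hM : ∀ x, ‖v x‖ ≤ M) (hB : ∀ x, ‖fderiv ℝ v x‖ ≤ B)
    (h1 : ∫⁻ x, ‖iteratedFDeriv ℝ 1 v x‖ₑ ^ 2 < ⊤) (h2 : ∫⁻ x, ‖iteratedFDeriv ℝ 2 v x‖ₑ ^ 2 < ⊤)
    (hpos : 0 < M * Real.sqrt (∫ x, ‖curl v x‖ ^ 2) * Real.sqrt (∫ x, frobeniusNormSq (fderiv ℝ (curl v) x)))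
    (hatt : |∫ x, ⟪curl v x, fderiv ℝ v x (curl v x)⟫| = (sInf {κ : ℝ | (∀ (v : EuclideanSpace ℝ (Fin 3) → EuclideanSpace ℝ (Fin 3)) (M B : ℝ), ContDiff ℝ (⊤ : ℕ∞) v → Literature.Analysis.FluidPDE.VectorCalculus.IsDivFree v → (∀ x, ‖v x‖ ≤ M) → (∀ x, ‖fderiv ℝ v x‖ ≤ B) → (∫⁻ x, ‖iteratedFDeriv ℝ 0 v x‖ₑ ^ 2 < ⊤) → (∫⁻ x, ‖iteratedFDeriv ℝ 1 v x‖ₑ ^ 2 < ⊤) → (∫⁻ x, ‖iteratedFDeriv ℝ 2 v x‖ₑ ^ 2 < ⊤) → |∫ x, ⟪Literature.Analysis.FluidPDE.curl v x, fderiv ℝ v x (Literature.Analysis.FluidPDE.curl v x)⟫_ℝ| ≤ κ * M * Real.sqrt (∫ x, ‖Literature.Analysis.FluidPDE.curl v x‖ ^ 2) * Real.sqrt (∫ x, Literature.Analysis.FluidPDE.frobeniusNormSq (fderiv ℝ (Literature.Analysis.FluidPDE.curl v) x)))}) * M * Real.sqrt (∫ x, ‖curl v x‖ ^ 2) * Real.sqrt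 (∫ x, frobeniusNormSq (fderiv ℝ (curl v) x)))
    (hM' : M' < M) (hR : ∀ x : EuclideanSpace ℝ (Fin 3), R ≤ ‖x‖ → ‖v x‖ ≤ M') :
    (interior {x | ‖v x‖ = M}).Nonempty := by
  have hK : 0 < (sInf {κ : ℝ | (∀ (v : EuclideanSpace ℝ (Fin 3) → EuclideanSpace ℝ (Fin 3)) (M B : ℝ), ContDiff ℝ (⊤ : ℕ∞) v → Literature.Analysis.FluidPDE.VectorCalculus.IsDivFree v → (∀ x, ‖v x‖ ≤ M) → (∀ x, ‖fderiv ℝ v x‖ ≤ B) → (∫⁻ x, ‖iteratedFDeriv ℝ 0 v x‖ₑ ^ 2 < ⊤) → (∫⁻ x, ‖iteratedFDeriv ℝ 1 v x‖ₑ ^ 2 < ⊤) → (∫⁻ x, ‖iteratedFDeriv ℝ 2 v x‖ₑ ^ 2 < ⊤) → |∫ x, ⟪Literature.Analysis.FluidPDE.curl v x, fderiv ℝ v x (Literature.Analysis.FluidPDE.curl v x)⟫_ℝ| ≤ κ * M * Real.sqrt (∫ x, ‖Literature.Analysis.FluidPDE.curl v x‖ ^ 2) * Real.sqrt (∫ x,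 Literature.Analysis.FluidPDE.frobeniusNormSq (fderiv ℝ (Literature.Analysis.FluidPDE.curl v) x)))}) := lt_trans (by norm_num) DepletionLadder.sharpDepletion_gt
  have hM0 : 0 ≤ M := (norm_nonneg _).trans (hM 0)
  have hZ0 : 0 ≤ ∫ x, ‖curl v x‖ ^ 2 := integral_nonneg fun x => sq_nonneg _
  have hW0 : 0 ≤ ∫ x, frobeniusNormSq (fderiv ℝ (curl v) x) := integral_nonneg fun x => frobeniusNormSq_nonneg _
  have hMpos : 0 < M := by
    rcases hM0.eq_or_lt with h | h
    · rw [← h, zero_mul, zero_mul] at hpos; exact absurd hpos (lt_irrefl _)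
    · exact h
  have hZpos : 0 < ∫ x, ‖curl v x‖ ^ 2 := by
    rcases hZ0.eq_or_lt with h | h
    · rw [← h, Real.sqrt_zero, mul_zero, zero_mul] at hpos; exact absurd hpos (lt_irrefl _)
    · exact h
  have hWpos : 0 < ∫ x, frobeniusNormSq (fderiv ℝ (curl v) x) := by
    rcases hW0.eq_or_lt with h | h
    · rw [← h, Real.sqrt_zero, mul_zero] at hpos; exact absurd hpos (lt_irrefl _)
    · exact h
  by_contra hne
  rw [not_nonempty_iff_eq_empty, interior_eq_empty_iff_dense_compl] at hne
  have hUeq : ({x | ‖v x‖ = M} : Set (EuclideanSpace ℝ (Fin 3)))ᶜ = {x | ‖v x‖ < M} := by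
    ext x
    simp only [mem_compl_iff, mem_setOf_eq]
    exact ⟨fun h => lt_of_le_of_ne (hM x) h, fun h => ne_of_lt h⟩
  rw [hUeq] at hne
  have hUo : IsOpen {x | ‖v x‖ < M} := isOpen_lt (continuous_norm.comp hv.continuous) continuous_const
  -- the continuous density of `ℓ ∘ curl`
  obtain ⟨G, hGc, hG⟩ := exists_density hv (∫ x, ⟪curl v x, fderiv ℝ v x (curl v x)⟫)
    (-((sInf {κ : ℝ | (∀ (v : EuclideanSpace ℝ (Fin 3) → EuclideanSpace ℝ (Fin 3)) (M B : ℝ), ContDiff ℝ (⊤ : ℕ∞) v → Literature.Analysis.FluidPDE.VectorCalculus.IsDivFree v → (∀ x, ‖v x‖ ≤ M) → (∀ x, ‖fderiv ℝ v x‖ ≤ B) → (∫⁻ x, ‖iteratedFDeriv ℝ 0 v x‖ₑ ^ 2 < ⊤) → (∫⁻ x, ‖iteratedFDeriv ℝ 1 v x‖ₑ ^ 2 < ⊤) → (∫⁻ x, ‖iteratedFDeriv ℝ 2 v x‖ₑ ^ 2 < ⊤) → |∫ x, ⟪Literature.Analysis.FluidPDE.curl v x, fderiv ℝ v x (Literature.Analysis.FluidPDE.curl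 v x)⟫_ℝ| ≤ κ * M * Real.sqrt (∫ x, ‖Literature.Analysis.FluidPDE.curl v x‖ ^ 2) * Real.sqrt (∫ x, Literature.Analysis.FluidPDE.frobeniusNormSq (fderiv ℝ (Literature.Analysis.FluidPDE.curl v) x)))}) ^ 2 * M ^ 2 * (∫ x, frobeniusNormSq (fderiv ℝ (curl v) x))))
    (-((sInf {κ : ℝ | (∀ (v : EuclideanSpace ℝ (Fin 3) → EuclideanSpace ℝ (Fin 3)) (M B : ℝ), ContDiff ℝ (⊤ : ℕ∞) v → Literature.Analysis.FluidPDE.VectorCalculus.IsDivFree v → (∀ x, ‖v x‖ ≤ M) → (∀ x, ‖fderiv ℝ v x‖ ≤ B) → (∫⁻ x, ‖iteratedFDeriv ℝ 0 v x‖ₑ ^ 2 < ⊤) → (∫⁻ x, ‖iteratedFDeriv ℝ 1 v x‖ₑ ^ 2 < ⊤) → (∫⁻ x, ‖iteratedFDeriv ℝ 2 v x‖ₑ ^ 2 < ⊤) → |∫ x, ⟪Literature.Analysis.FluidPDE.curl v x, fderiv ℝ v x (Literature.Analysis.FluidPDE.curl v x)⟫_ℝ| ≤ κ * M * Real.sqrt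 (∫ x, ‖Literature.Analysis.FluidPDE.curl v x‖ ^ 2) * Real.sqrt (∫ x, Literature.Analysis.FluidPDE.frobeniusNormSq (fderiv ℝ (Literature.Analysis.FluidPDE.curl v) x)))}) ^ 2 * M ^ 2 * (∫ x, ‖curl v x‖ ^ 2)))
  have hℓ : ∀ η : EuclideanSpace ℝ (Fin 3) → EuclideanSpace ℝ (Fin 3), ContDiff ℝ ∞ η → HasCompactSupport η →
      (∫ x, ⟪curl v x, fderiv ℝ v x (curl v x)⟫) * (∫ x, (⟪curl (curl η) x, fderiv ℝ v x (curl v x)⟫ + ⟪curl v x, fderiv ℝ (curl η) x (curl v x)⟫ +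
          ⟪curl v x, fderiv ℝ v x (curl (curl η) x)⟫)) - (sInf {κ : ℝ | (∀ (v : EuclideanSpace ℝ (Fin 3) → EuclideanSpace ℝ (Fin 3)) (M B : ℝ), ContDiff ℝ (⊤ : ℕ∞) v → Literature.Analysis.FluidPDE.VectorCalculus.IsDivFree v → (∀ x, ‖v x‖ ≤ M) → (∀ x, ‖fderiv ℝ v x‖ ≤ B) → (∫⁻ x, ‖iteratedFDeriv ℝ 0 v x‖ₑ ^ 2 < ⊤) → (∫⁻ x, ‖iteratedFDeriv ℝ 1 v x‖ₑ ^ 2 < ⊤) → (∫⁻ x, ‖iteratedFDeriv ℝ 2 v x‖ₑ ^ 2 < ⊤) → |∫ x, ⟪Literature.Analysis.FluidPDE.curl v x, fderiv ℝ v x (Literature.Analysis.FluidPDE.curl v x)⟫_ℝ| ≤ κ * M * Real.sqrt (∫ x, ‖Literature.Analysis.FluidPDE.curl v x‖ ^ 2) * Real.sqrt (∫ x, Literature.Analysis.FluidPDE.frobeniusNormSq (fderiv ℝ (Literature.Analysis.FluidPDE.curl v) x)))}) ^ 2 * M ^ 2 * ((∫ x, frobeniusNormSq (fderiv ℝ (curl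 v) x)) * (∫ x, ⟪curl v x, curl (curl η) x⟫) + (∫ x, ‖curl v x‖ ^ 2) * (∫ x, ∑ i, ⟪fderiv ℝ (curl v) x (EuclideanSpace.basisFun (Fin 3) ℝ i),
          fderiv ℝ (curl (curl η)) x (EuclideanSpace.basisFun (Fin 3) ℝ i)⟫)) = ∫ x, ⟪G x, η x⟫ := by
    intro η hη hηc
    rw [← hG η hη hηc]
    ring
  have hℓ0 : ∀ η : EuclideanSpace ℝ (Fin 3) → EuclideanSpace ℝ (Fin 3), ContDiff ℝ ∞ η → HasCompactSupport η →
      tsupport η ⊆ {x | ‖v x‖ < M} → ∫ x, ⟪G x, η x⟫ = 0 := by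
    intro η hη hηc hηU
    have hcη : ContDiff ℝ ∞ (curl η) := contDiff_curl_top hη
    have h := ext_firstVariation_eq_zero_offContact (φ := curl η) hext hv hdiv hM hB h1 h2 hatt hcη
      (hasCompactSupport_curl hηc) (fun x => divergence_curl_eq_zero_holds η (hη.of_le (by norm_cast)) x)
      ((tsupport_curl_subset η).trans hηU)
    rw [← hℓ η hη hηc, h]
    ring
  have hGae : ∀ᵐ x ∂(volume : Measure (EuclideanSpace ℝ (Fin 3))), x ∈ {x | ‖v x‖ < M} → G x = 0 := by
    refine hUo.ae_eq_zero_of_integral_contDiff_smul_eq_zero (hGc.locallyIntegrable.locallyIntegrableOn _)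
      fun θ hθ hθc hθU => ?_
    have hint : Integrable (fun x => θ x • G x) (volume : Measure (EuclideanSpace ℝ (Fin 3))) :=
      (hθ.continuous.smul hGc).integrable_of_hasCompactSupport hθc.smul_right
    refine ext_inner_left ℝ fun e => ?_
    rw [inner_zero_right, ← integral_inner hint e]
    have hη : ContDiff ℝ ∞ fun x => θ x • e := hθ.smul contDiff_const
    have hηc : HasCompactSupport fun x => θ x • e := hθc.smul_right
    have hηU : tsupport (fun x => θ x • e) ⊆ {x | ‖v x‖ < M} := (tsupport_smul_subset_left _ _).trans hθU
    have hpt : ∀ x, ⟪e, θ x • G x⟫ = ⟪G x, θ x • e⟫ := fun x => by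
      rw [inner_smul_right, inner_smul_right, real_inner_comm]
    rw [integral_congr_ae (Eventually.of_forall hpt)]
    exact hℓ0 _ hη hηc hηU
  have hGU : EqOn G 0 {x | ‖v x‖ < M} :=
    Measure.eqOn_open_of_ae_eq ((ae_restrict_iff' hUo.measurableSet).2 hGae) hUo hGc.continuousOn
      continuousOn_const
  have hG0 : G = 0 := Continuous.ext_on hne hGc continuous_const hGU
  -- the cut-off perturbation `φ_R = curl (χ · conePotential v)` with a TWO-SIDED norm bound from the far-field gap
  set R₀ := max R 0 with hR₀
  have hR' : ∀ x : EuclideanSpace ℝ (Fin 3), R₀ ≤ ‖x‖ → ‖v x‖ ≤ M' := fun x hx => hR x ((le_max_left _ _).trans hx)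
  let χ : ContDiffBump (0 : EuclideanSpace ℝ (Fin 3)) := ⟨R₀ + 1, R₀ + 2, by positivity, by linarith⟩
  obtain ⟨hφ, hφc, hφdiv, -⟩ := cutoff_field hv hdiv χ
  obtain ⟨ε₀, hε₀, hbound⟩ := ext_exists_normBound_cutoff hv hdiv hM hMpos hM' hR' χ (by
    show R₀ < R₀ + 1
    linarith)
  have hm1 := ext_firstVariation_eq_of_normBound hext hv hdiv hB h1 h2 hatt hφ hφc hφdiv hε₀ hbound
  have hη : ContDiff ℝ ∞ fun y => χ y • conePotential v y := χ.contDiff.smul (contDiff_conePotential hv)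
  have hηc : HasCompactSupport fun y => χ y • conePotential v y := χ.hasCompactSupport.smul_right
  have hℓR := hℓ _ hη hηc
  rw [hG0] at hℓR
  simp only [Pi.zero_apply, inner_zero_left, integral_zero] at hℓR
  rw [hm1] at hℓR
  have : (sInf {κ : ℝ | (∀ (v : EuclideanSpace ℝ (Fin 3) → EuclideanSpace ℝ (Fin 3)) (M B : ℝ), ContDiff ℝ (⊤ : ℕ∞) v → Literature.Analysis.FluidPDE.VectorCalculus.IsDivFree v → (∀ x, ‖v x‖ ≤ M) → (∀ x, ‖fderiv ℝ v x‖ ≤ B) → (∫⁻ x, ‖iteratedFDeriv ℝ 0 v x‖ₑ ^ 2 < ⊤) → (∫⁻ x, ‖iteratedFDeriv ℝ 1 v x‖ₑ ^ 2 < ⊤) → (∫⁻ x, ‖iteratedFDeriv ℝ 2 v x‖ₑ ^ 2 < ⊤) → |∫ x, ⟪Literature.Analysis.FluidPDE.curl v x, fderiv ℝ v x (Literature.Analysis.FluidPDE.curl v x)⟫_ℝ| ≤ κ * M * Real.sqrt (∫ x, ‖Literature.Analysis.FluidPDE.curl v x‖ ^ 2) * Real.sqrt (∫ x, Literature.Analysis.FluidPDE.frobeniusNormSq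 (fderiv ℝ (Literature.Analysis.FluidPDE.curl v) x)))}) ^ 2 * M ^ 2 * ((∫ x, ‖curl v x‖ ^ 2) * (∫ x, frobeniusNormSq (fderiv ℝ (curl v) x))) = 0 := by
    linear_combination hℓR
  have hprod : 0 < (sInf {κ : ℝ | (∀ (v : EuclideanSpace ℝ (Fin 3) → EuclideanSpace ℝ (Fin 3)) (M B : ℝ), ContDiff ℝ (⊤ : ℕ∞) v → Literature.Analysis.FluidPDE.VectorCalculus.IsDivFree v → (∀ x, ‖v x‖ ≤ M) → (∀ x, ‖fderiv ℝ v x‖ ≤ B) → (∫⁻ x, ‖iteratedFDeriv ℝ 0 v x‖ₑ ^ 2 < ⊤) → (∫⁻ x, ‖iteratedFDeriv ℝ 1 v x‖ₑ ^ 2 < ⊤) → (∫⁻ x, ‖iteratedFDeriv ℝ 2 v x‖ₑ ^ 2 < ⊤) → |∫ x, ⟪Literature.Analysis.FluidPDE.curl v x, fderiv ℝ v x (Literature.Analysis.FluidPDE.curl v x)⟫_ℝ| ≤ κ * M * Real.sqrt (∫ x, ‖Literature.Analysis.FluidPDE.curl v x‖ ^ 2) * Real.sqrt (∫ x, Literature.Analysis.FluidPDE.frobeniusNormSq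 (fderiv ℝ (Literature.Analysis.FluidPDE.curl v) x)))}) ^ 2 * M ^ 2 * ((∫ x, ‖curl v x‖ ^ 2) * (∫ x, frobeniusNormSq (fderiv ℝ (curl v) x))) := by
    positivity
  exact absurd this hprod.ne'

/-- **No real-analytic extended extremiser with a far-field gap** (port of `KStar.not_attained_of_analyticOnNhd`). [folklore] -/
theorem ext_not_extremal_of_analytic_of_farFieldGap
    (hext : ∀ (w : EuclideanSpace ℝ (Fin 3) → EuclideanSpace ℝ (Fin 3)) (M B : ℝ), ContDiff ℝ (⊤ : ℕ∞) w → Literature.Analysis.FluidPDE.VectorCalculus.IsDivFree w → (∀ x, ‖w x‖ ≤ M) → (∀ x, ‖fderiv ℝ w x‖ ≤ B) → (∫⁻ x, ‖iteratedFDeriv ℝ 1 w x‖ₑ ^ 2 < ⊤) → (∫⁻ x, ‖iteratedFDeriv ℝ 2 w x‖ₑ ^ 2 < ⊤) → |∫ x, ⟪Literature.Analysis.FluidPDE.curl w x, fderiv ℝ w x (Literature.Analysis.FluidPDE.curl w x)⟫_ℝ| ≤ (sInf {κ : ℝ | (∀ (v : EuclideanSpace ℝ (Fin 3) → EuclideanSpace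 ℝ (Fin 3)) (M B : ℝ), ContDiff ℝ (⊤ : ℕ∞) v → Literature.Analysis.FluidPDE.VectorCalculus.IsDivFree v → (∀ x, ‖v x‖ ≤ M) → (∀ x, ‖fderiv ℝ v x‖ ≤ B) → (∫⁻ x, ‖iteratedFDeriv ℝ 0 v x‖ₑ ^ 2 < ⊤) → (∫⁻ x, ‖iteratedFDeriv ℝ 1 v x‖ₑ ^ 2 < ⊤) → (∫⁻ x, ‖iteratedFDeriv ℝ 2 v x‖ₑ ^ 2 < ⊤) → |∫ x, ⟪Literature.Analysis.FluidPDE.curl v x, fderiv ℝ v x (Literature.Analysis.FluidPDE.curl v x)⟫_ℝ| ≤ κ * M * Real.sqrt (∫ x, ‖Literature.Analysis.FluidPDE.curl v x‖ ^ 2) * Real.sqrt (∫ x, Literature.Analysis.FluidPDE.frobeniusNormSq (fderiv ℝ (Literature.Analysis.FluidPDE.curl v) x)))}) * M * Real.sqrt (∫ x, ‖Literature.Analysis.FluidPDE.curl w x‖ ^ 2) * Real.sqrt (∫ x, Literature.Analysis.FluidPDE.frobeniusNormSq (fderiv ℝ (Literature.Analysis.FluidPDE.curl w) x)))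
    (hv : ContDiff ℝ ∞ v) (han : AnalyticOnNhd ℝ v univ) (hdiv : VectorCalculus.IsDivFree v) {M B M' R : ℝ}
    (hM : ∀ x, ‖v x‖ ≤ M) (hB : ∀ x, ‖fderiv ℝ v x‖ ≤ B)
    (h1 : ∫⁻ x, ‖iteratedFDeriv ℝ 1 v x‖ₑ ^ 2 < ⊤) (h2 : ∫⁻ x, ‖iteratedFDeriv ℝ 2 v x‖ₑ ^ 2 < ⊤)
    (hpos : 0 < M * Real.sqrt (∫ x, ‖curl v x‖ ^ 2) * Real.sqrt (∫ x, frobeniusNormSq (fderiv ℝ (curl v) x)))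
    (hM' : M' < M) (hR : ∀ x : EuclideanSpace ℝ (Fin 3), R ≤ ‖x‖ → ‖v x‖ ≤ M') :
    |∫ x, ⟪curl v x, fderiv ℝ v x (curl v x)⟫| ≠
      (sInf {κ : ℝ | (∀ (v : EuclideanSpace ℝ (Fin 3) → EuclideanSpace ℝ (Fin 3)) (M B : ℝ), ContDiff ℝ (⊤ : ℕ∞) v → Literature.Analysis.FluidPDE.VectorCalculus.IsDivFree v → (∀ x, ‖v x‖ ≤ M) → (∀ x, ‖fderiv ℝ v x‖ ≤ B) → (∫⁻ x, ‖iteratedFDeriv ℝ 0 v x‖ₑ ^ 2 < ⊤) → (∫⁻ x, ‖iteratedFDeriv ℝ 1 v x‖ₑ ^ 2 < ⊤) → (∫⁻ x, ‖iteratedFDeriv ℝ 2 v x‖ₑ ^ 2 < ⊤) → |∫ x, ⟪Literature.Analysis.FluidPDE.curl v x, fderiv ℝ v x (Literature.Analysis.FluidPDE.curl v x)⟫_ℝ| ≤ κ * M * Real.sqrt (∫ x, ‖Literature.Analysis.FluidPDE.curl v x‖ ^ 2) * Real.sqrt (∫ x, Literature.Analysis.FluidPDE.frobeniusNormSq (fderiv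 ℝ (Literature.Analysis.FluidPDE.curl v) x)))}) * M * Real.sqrt (∫ x, ‖curl v x‖ ^ 2) * Real.sqrt (∫ x, frobeniusNormSq (fderiv ℝ (curl v) x)) := by
  intro hatt
  obtain ⟨x₀, hx₀⟩ := ext_interior_contact_nonempty hext hv hdiv hM hB h1 h2 hpos hatt hM' hR
  have hsq : AnalyticOnNhd ℝ (fun x => ‖v x‖ ^ 2) univ := by
    have hcoord : ∀ i : Fin 3, AnalyticOnNhd ℝ (fun x => v x i) univ := fun i =>
      (EuclideanSpace.proj i : EuclideanSpace ℝ (Fin 3) →L[ℝ] ℝ).comp_analyticOnNhd han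
    have heq : (fun x => ‖v x‖ ^ 2) = fun x => ∑ i, v x i * v x i := by
      funext x
      rw [EuclideanSpace.norm_eq, Real.sq_sqrt (Finset.sum_nonneg fun i _ => sq_nonneg _)]
      exact Finset.sum_congr rfl fun i _ => by rw [Real.norm_eq_abs, sq_abs, sq]
    rw [heq]
    exact Finset.analyticOnNhd_fun_sum _ fun i _ => (hcoord i).mul (hcoord i)
  have hev : (fun x => ‖v x‖ ^ 2) =ᶠ[𝓝 x₀] fun _ => M ^ 2 := by
    filter_upwards [mem_interior_iff_mem_nhds.1 hx₀] with x hx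
    have hx' : ‖v x‖ = M := hx
    rw [hx']
  have hconst : (fun x => ‖v x‖ ^ 2) = fun _ => M ^ 2 := hsq.eq_of_eventuallyEq analyticOnNhd_const hev
  obtain ⟨x, hx⟩ := NormedSpace.exists_lt_norm ℝ (EuclideanSpace ℝ (Fin 3)) R
  have h1' := hR x hx.le
  have h2' : ‖v x‖ ^ 2 = M ^ 2 := congrFun hconst x
  have hM0 : 0 ≤ M := (norm_nonneg _).trans (hM 0)
  nlinarith [norm_nonneg (v x)]

/-! ## The registered stub from the extended sharp inequality and the «plateau at infinity» exclusion -/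

/-- **K1b ⟸ (extended sharp inequality) ∧ (no analytic extended extremiser whose sup is approached at infinity).**  A violator
`w` of the registered stub is, by `hext`, an exact extended extremiser with `M = sup ‖w‖` effectively; if `‖w‖ ≤ M' < M` off some
ball, `ext_not_extremal_of_analytic_of_farFieldGap` excludes it; otherwise its sup is approached at infinity
(`∀ M' < M, ∀ R, ∃ x, ‖x‖ ≥ R ∧ ‖w x‖ > M'`) — the «plateau at infinity», excluded by the hypothesis `hplateau`, which is NOT
proved here (it is where K1b's difficulty now concentrates).  The conclusion is the registered stub VERBATIM. [folklore] -/
theorem stub_noAnalyticExtremal_of_extendedSharp_of_noPlateauAtInfinity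
    (hext : ∀ (w : EuclideanSpace ℝ (Fin 3) → EuclideanSpace ℝ (Fin 3)) (M B : ℝ), ContDiff ℝ (⊤ : ℕ∞) w → Literature.Analysis.FluidPDE.VectorCalculus.IsDivFree w → (∀ x, ‖w x‖ ≤ M) → (∀ x, ‖fderiv ℝ w x‖ ≤ B) → (∫⁻ x, ‖iteratedFDeriv ℝ 1 w x‖ₑ ^ 2 < ⊤) → (∫⁻ x, ‖iteratedFDeriv ℝ 2 w x‖ₑ ^ 2 < ⊤) → |∫ x, ⟪Literature.Analysis.FluidPDE.curl w x, fderiv ℝ w x (Literature.Analysis.FluidPDE.curl w x)⟫_ℝ| ≤ (sInf {κ : ℝ | (∀ (v : EuclideanSpace ℝ (Fin 3) → EuclideanSpace ℝ (Fin 3)) (M B : ℝ), ContDiff ℝ (⊤ : ℕ∞) v → Literature.Analysis.FluidPDE.VectorCalculus.IsDivFree v → (∀ x, ‖v x‖ ≤ M) → (∀ x, ‖fderiv ℝ v x‖ ≤ B) → (∫⁻ x, ‖iteratedFDeriv ℝ 0 v x‖ₑ ^ 2 < ⊤) → (∫⁻ x, ‖iteratedFDeriv ℝ 1 v x‖ₑ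 ^ 2 < ⊤) → (∫⁻ x, ‖iteratedFDeriv ℝ 2 v x‖ₑ ^ 2 < ⊤) → |∫ x, ⟪Literature.Analysis.FluidPDE.curl v x, fderiv ℝ v x (Literature.Analysis.FluidPDE.curl v x)⟫_ℝ| ≤ κ * M * Real.sqrt (∫ x, ‖Literature.Analysis.FluidPDE.curl v x‖ ^ 2) * Real.sqrt (∫ x, Literature.Analysis.FluidPDE.frobeniusNormSq (fderiv ℝ (Literature.Analysis.FluidPDE.curl v) x)))}) * M * Real.sqrt (∫ x, ‖Literature.Analysis.FluidPDE.curl w x‖ ^ 2) * Real.sqrt (∫ x, Literature.Analysis.FluidPDE.frobeniusNormSq (fderiv ℝ (Literature.Analysis.FluidPDE.curl w) x)))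
    (hplateau : ¬ ∃ (w : EuclideanSpace ℝ (Fin 3) → EuclideanSpace ℝ (Fin 3)), AnalyticOnNhd ℝ w Set.univ ∧ (ContDiff ℝ (⊤ : ℕ∞) w ∧ Literature.Analysis.FluidPDE.VectorCalculus.IsDivFree w ∧ (∃ B : ℝ, ∀ x, ‖fderiv ℝ w x‖ ≤ B) ∧ (∫⁻ x, ‖iteratedFDeriv ℝ 1 w x‖ₑ ^ 2 < ⊤) ∧ (∫⁻ x, ‖iteratedFDeriv ℝ 2 w x‖ₑ ^ 2 < ⊤) ∧ ∃ M : ℝ, (∀ x, ‖w x‖ ≤ M) ∧ 0 < M * Real.sqrt (∫ x, ‖Literature.Analysis.FluidPDE.curl w x‖ ^ 2) * Real.sqrt (∫ x, Literature.Analysis.FluidPDE.frobeniusNormSq (fderiv ℝ (Literature.Analysis.FluidPDE.curl w) x)) ∧ (sInf {κ : ℝ | (∀ (v : EuclideanSpace ℝ (Fin 3) → EuclideanSpace ℝ (Fin 3)) (M B : ℝ), ContDiff ℝ (⊤ : ℕ∞) v → Literature.Analysis.FluidPDE.VectorCalculus.IsDivFree v → (∀ x, ‖v x‖ ≤ M)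 → (∀ x, ‖fderiv ℝ v x‖ ≤ B) → (∫⁻ x, ‖iteratedFDeriv ℝ 0 v x‖ₑ ^ 2 < ⊤) → (∫⁻ x, ‖iteratedFDeriv ℝ 1 v x‖ₑ ^ 2 < ⊤) → (∫⁻ x, ‖iteratedFDeriv ℝ 2 v x‖ₑ ^ 2 < ⊤) → |∫ x, ⟪Literature.Analysis.FluidPDE.curl v x, fderiv ℝ v x (Literature.Analysis.FluidPDE.curl v x)⟫_ℝ| ≤ κ * M * Real.sqrt (∫ x, ‖Literature.Analysis.FluidPDE.curl v x‖ ^ 2) * Real.sqrt (∫ x, Literature.Analysis.FluidPDE.frobeniusNormSq (fderiv ℝ (Literature.Analysis.FluidPDE.curl v) x)))}) * M * Real.sqrt (∫ x, ‖Literature.Analysis.FluidPDE.curl w x‖ ^ 2) * Real.sqrt (∫ x, Literature.Analysis.FluidPDE.frobeniusNormSq (fderiv ℝ (Literature.Analysis.FluidPDE.curl w) x)) = |∫ x, ⟪Literature.Analysis.FluidPDE.curl w x, fderiv ℝ w x (Literature.Analysis.FluidPDE.curl w x)⟫_ℝ| ∧ (∀ M' : ℝ, M' < M → ∀ R : ℝ,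 ∃ x, R ≤ ‖x‖ ∧ M' < ‖w x‖))) :
    ¬ ∃ (w : EuclideanSpace ℝ (Fin 3) → EuclideanSpace ℝ (Fin 3)), AnalyticOnNhd ℝ w Set.univ ∧ (ContDiff ℝ (⊤ : ℕ∞) w ∧ Literature.Analysis.FluidPDE.VectorCalculus.IsDivFree w ∧ (∃ B : ℝ, ∀ x, ‖fderiv ℝ w x‖ ≤ B) ∧ (∫⁻ x, ‖iteratedFDeriv ℝ 1 w x‖ₑ ^ 2 < ⊤) ∧ (∫⁻ x, ‖iteratedFDeriv ℝ 2 w x‖ₑ ^ 2 < ⊤) ∧ ∃ M : ℝ, (∀ x, ‖w x‖ ≤ M) ∧ 0 < M * Real.sqrt (∫ x, ‖Literature.Analysis.FluidPDE.curl w x‖ ^ 2) * Real.sqrt (∫ x, Literature.Analysis.FluidPDE.frobeniusNormSq (fderiv ℝ (Literature.Analysis.FluidPDE.curl w) x)) ∧ (sInf {κ : ℝ | (∀ (v : EuclideanSpace ℝ (Fin 3) → EuclideanSpace ℝ (Fin 3)) (M B : ℝ), ContDiff ℝ (⊤ : ℕ∞) v → Literature.Analysis.FluidPDE.VectorCalculus.IsDivFree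 v → (∀ x, ‖v x‖ ≤ M) → (∀ x, ‖fderiv ℝ v x‖ ≤ B) → (∫⁻ x, ‖iteratedFDeriv ℝ 0 v x‖ₑ ^ 2 < ⊤) → (∫⁻ x, ‖iteratedFDeriv ℝ 1 v x‖ₑ ^ 2 < ⊤) → (∫⁻ x, ‖iteratedFDeriv ℝ 2 v x‖ₑ ^ 2 < ⊤) → |∫ x, ⟪Literature.Analysis.FluidPDE.curl v x, fderiv ℝ v x (Literature.Analysis.FluidPDE.curl v x)⟫_ℝ| ≤ κ * M * Real.sqrt (∫ x, ‖Literature.Analysis.FluidPDE.curl v x‖ ^ 2) * Real.sqrt (∫ x, Literature.Analysis.FluidPDE.frobeniusNormSq (fderiv ℝ (Literature.Analysis.FluidPDE.curl v) x)))}) * M * Real.sqrt (∫ x, ‖Literature.Analysis.FluidPDE.curl w x‖ ^ 2) * Real.sqrt (∫ x, Literature.Analysis.FluidPDE.frobeniusNormSq (fderiv ℝ (Literature.Analysis.FluidPDE.curl w) x)) ≤ |∫ x, ⟪Literature.Analysis.FluidPDE.curl w x, fderiv ℝ w x (Literature.Analysis.FluidPDE.curl w x)⟫_ℝ|) := by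
  rintro ⟨w, han, hcd, hdiv, ⟨B, hB⟩, h1, h2, M, hM, hpos, hge⟩
  have hle := hext w M B hcd hdiv hM hB h1 h2
  have heq := le_antisymm hge hle
  by_cases hgap : ∃ M' : ℝ, M' < M ∧ ∃ R : ℝ, ∀ x, R ≤ ‖x‖ → ‖w x‖ ≤ M'
  · obtain ⟨M', hM', R, hR⟩ := hgap
    exact ext_not_extremal_of_analytic_of_farFieldGap hext hcd han hdiv hM hB h1 h2 hpos hM' hR heq.symm
  · refine hplateau ⟨w, han, hcd, hdiv, ⟨B, hB⟩, h1, h2, M, hM, hpos, heq, fun M' hM' R => ?_⟩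
    by_contra hno
    refine hgap ⟨M', hM', R, fun x hx => ?_⟩
    by_contra hlt
    exact hno ⟨x, hx, lt_of_not_ge hlt⟩

end ExtremiserLiouville

end Summit.NavierStokesRegularity.NavierStokesRegularity.Theorems

end
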